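import Summits.Ventures.CertifiedManyBodySolver.Theorems.ThermalStiffnessCeilingU8b8_le_7o44.Negative.LocalChargeBookkeeping
import Summits.Ventures.CertifiedManyBodySolver.Theorems.ThermalStiffnessCeilingU8b8_le_7o44.Negative.CurrentClusteringSectorFree
import HarnessLib

/-!
# Parity AND sector bookkeeping are redundant in the current-clustering hypothesis: Hypothesis C is clustering against the full local
algebra (negative-side helper for the cruxes K1′ / K1 of route `TcThermcert1`)

Disprover's helper (`--supports stmt-Ventures-24560`; crux K1′ `TcThermcert1.ThermalStiffnessCeilingU8b8_le_7o44`, line of record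
`Cruxes/ThermalStiffnessCeilingU8b8_le_7o44/Lines/gauge_qbp_far_seam.lean` v1.6, bet C8 `stub_currentClustering8`; equally the K1 twin's
C10): finding F10, the torus corollary of `LocalChargeBookkeeping.lean`, sequel of F9 (`CurrentClusteringSectorFree.lean`).

LOAD-BEARING ANALYSIS of Hypothesis C (`CurrentClustering U n β ξ` of the line), continued. F9 deleted `SectorPreserving L (1−n) A`;
F10 deletes the PARITY restriction as well: Hypothesis C is EQUIVALENT, for every `U`, `n`, `β`, `ξ`, to exponential clustering of the
flux-free canonical Gibbs state between the bond current and EVERY element of the FULL local CAR algebra `𝔄(orbSet X)` — odd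
observables (a single `c_x`, `c†_x c†_y c_z`, …) included (`currentClusteringBody_sectorFree_iff_local`,
`currentClusteringBody_iff_local`; constants `(C, k, L₀) ↦ (4·max C 0, k + 2, L₀)`). Mechanism: the local charge pinching
`A₀ = Σ_q Π_q A Π_q` of ANY `A ∈ 𝔄(orbSet X)` is even, local and sector preserving (`LocalChargeBookkeeping.locPinch_mem_of_mem_carSubalgebra`:
a Jordan–Wigner word shifts the local charges by a fixed vector whose total has the parity of the word length, so the pinching keeps exactly
the charge-neutral — hence even — words), its sector blocks against the current are those of `A` (F9) and `‖A₀‖ ≤ (|X|+1)²‖A‖ ≤ 4|X|²‖A‖`;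
an observable of the empty window is a scalar, with covariance `0` because `ω_p(j) = 0` (F1).

READING for the bet C8 / the lead / prover cards built on Lieb–Robinson or KMS-strip bounds (which are parity-blind): the natural
target is `currentClusteringBody_iff_local`'s right side — "`|ω_p(A j) − ω_p(A) ω_p(j)| ≤ C ‖A‖ |X|^k e^{−d/ξ}` for all `A ∈ 𝔄(orbSet X)`",
no parity, no sector hypothesis; conversely a falsifier may use ANY local observable. Only `ξ > 0`, the distance premise (F5) and the
stiffness-side guards (F2) remain load-bearing in the logical form of C.

HONEST FRAMING: finite-dimensional folklore; NO KILL of K1′, of stub B or of the bet C8 is claimed, nothing here bears on clustering at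
`(U, n, β) = (8, 7/8, 8)`, and superconductivity in the Hubbard model is neither proved nor disproved by anything in this file.
-/

noncomputable section

open scoped ComplexOrder ComplexConjugate Matrix.Norms.L2Operator
open Filter Topology Matrix Finset
open Literature.MathematicalPhysics.QuantumLattice
open Literature.Probability.LatticeModels
open Summit.Ventures.CertifiedManyBodySolver.Theorems.TcThermcert1.GaugeQbpFarSeam
open Summit.Ventures.CertifiedManyBodySolver.Theorems.TcThermcert1.CurrentCovarianceTRBlind
open Summit.Ventures.CertifiedManyBodySolver.Theorems.TcThermcert1.CurrentCovarianceLocality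
open Summit.Ventures.CertifiedManyBodySolver.Theorems.TcThermcert1.CurrentCovarianceNonVacuity
open Summit.Ventures.CertifiedManyBodySolver.Theorems.TcThermcert1.LocalChargePinching
open Summit.Ventures.CertifiedManyBodySolver.Theorems.TcThermcert1.LocalChargeBookkeeping
open Summit.Ventures.CertifiedManyBodySolver.Theorems.TcThermcert1.CurrentClusteringSectorFree

namespace Summit.Ventures.CertifiedManyBodySolver.Theorems.TcThermcert1.CurrentClusteringLocalAlgebra

/-! ## §4 Hypothesis C against the even local algebra and against the full local algebra are equivalent -/

section Torus

/-- **F10a — parity is redundant in (sector-free) Hypothesis C.** The sector-free form of the line's `CurrentClustering U n β ξ`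
(right side of F9's `currentClusteringBody_iff_sectorFree`: test observables `A ∈ carEvenSubalgebra (orbSet X)`) is EQUIVALENT to the same
statement over the FULL local algebra `A ∈ carSubalgebra (orbSet X)`: given constants `(C, k, L₀)` for even local observables,
`(4·max C 0, k + 2, L₀)` serve for all local observables — apply the hypothesis to the local charge pinching `A₀` of `A` (even and local by
`locPinch_mem_of_mem_carSubalgebra`), whose covariance with the current equals that of `A` and whose norm is `≤ (|X|+1)²‖A‖ ≤ 4|X|²‖A‖`;
a scalar (`X = ∅`) has covariance `0` since `ω_p(j) = 0`. Every `U`, `n`, `β`, `ξ`. [folklore] -/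
theorem currentClusteringBody_sectorFree_iff_local (U n β ξ : ℝ) :
    (0 < ξ ∧ ∃ C : ℝ, ∃ k L₀ : ℕ, ∀ (L : ℕ) [NeZero L], L₀ ≤ L →
      ∀ (X : Finset (FermionTorus 2 L)) (A : Matrix (Finset (Orb (FermionTorus 2 L))) (Finset (Orb (FermionTorus 2 L))) ℂ),
        A ∈ carEvenSubalgebra (orbSet X) →
        ∀ (X₀ y : ZMod L) (d : ℕ),
          (∀ x ∈ X, d ≤ torusDist x.toTorusSite ![X₀, y] ∧ d ≤ torusDist x.toTorusSite ![X₀ - 1, y]) →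
          ‖gibbsState β ((hubbardTorusTT'Flux L 0 U 0).toBlock
                (fun s => s.card = 2 * ⌊(1 - (1 - n)) * (L : ℝ) ^ 2 / 2⌋₊ ∧
                  2 * (s.filter fun i => (ofLex i).2 = 0).card = 2 * ⌊(1 - (1 - n)) * (L : ℝ) ^ 2 / 2⌋₊)
                (fun s => s.card = 2 * ⌊(1 - (1 - n)) * (L : ℝ) ^ 2 / 2⌋₊ ∧
                  2 * (s.filter fun i => (ofLex i).2 = 0).card = 2 * ⌊(1 - (1 - n)) * (L : ℝ) ^ 2 / 2⌋₊))
              ((A * (∑ σ : Fin 2,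
                ((-Complex.I) • (creation (orb (FermionTorus.ofTorusSite (![X₀, y] : TorusSite 2 L)) σ) *
                    annihilation (orb (FermionTorus.ofTorusSite (![X₀ - 1, y] : TorusSite 2 L)) σ)) +
                  Complex.I • (creation (orb (FermionTorus.ofTorusSite (![X₀ - 1, y] : TorusSite 2 L)) σ) *
                    annihilation (orb (FermionTorus.ofTorusSite (![X₀, y] : TorusSite 2 L)) σ))))).toBlock
                (fun s => s.card = 2 * ⌊(1 - (1 - n)) * (L : ℝ) ^ 2 / 2⌋₊ ∧
                  2 * (s.filter fun i => (ofLex i).2 = 0).card = 2 * ⌊(1 - (1 - n)) * (L : ℝ) ^ 2 / 2⌋₊)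
                (fun s => s.card = 2 * ⌊(1 - (1 - n)) * (L : ℝ) ^ 2 / 2⌋₊ ∧
                  2 * (s.filter fun i => (ofLex i).2 = 0).card = 2 * ⌊(1 - (1 - n)) * (L : ℝ) ^ 2 / 2⌋₊))
            - gibbsState β ((hubbardTorusTT'Flux L 0 U 0).toBlock
                (fun s => s.card = 2 * ⌊(1 - (1 - n)) * (L : ℝ) ^ 2 / 2⌋₊ ∧
                  2 * (s.filter fun i => (ofLex i).2 = 0).card = 2 * ⌊(1 - (1 - n)) * (L : ℝ) ^ 2 / 2⌋₊)
                (fun s => s.card = 2 * ⌊(1 - (1 - n)) * (L : ℝ) ^ 2 / 2⌋₊ ∧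
                  2 * (s.filter fun i => (ofLex i).2 = 0).card = 2 * ⌊(1 - (1 - n)) * (L : ℝ) ^ 2 / 2⌋₊))
              (A.toBlock
                (fun s => s.card = 2 * ⌊(1 - (1 - n)) * (L : ℝ) ^ 2 / 2⌋₊ ∧
                  2 * (s.filter fun i => (ofLex i).2 = 0).card = 2 * ⌊(1 - (1 - n)) * (L : ℝ) ^ 2 / 2⌋₊)
                (fun s => s.card = 2 * ⌊(1 - (1 - n)) * (L : ℝ) ^ 2 / 2⌋₊ ∧
                  2 * (s.filter fun i => (ofLex i).2 = 0).card = 2 * ⌊(1 - (1 - n)) * (L : ℝ) ^ 2 / 2⌋₊))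
              * gibbsState β ((hubbardTorusTT'Flux L 0 U 0).toBlock
                (fun s => s.card = 2 * ⌊(1 - (1 - n)) * (L : ℝ) ^ 2 / 2⌋₊ ∧
                  2 * (s.filter fun i => (ofLex i).2 = 0).card = 2 * ⌊(1 - (1 - n)) * (L : ℝ) ^ 2 / 2⌋₊)
                (fun s => s.card = 2 * ⌊(1 - (1 - n)) * (L : ℝ) ^ 2 / 2⌋₊ ∧
                  2 * (s.filter fun i => (ofLex i).2 = 0).card = 2 * ⌊(1 - (1 - n)) * (L : ℝ) ^ 2 / 2⌋₊))
              ((∑ σ : Fin 2,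
                ((-Complex.I) • (creation (orb (FermionTorus.ofTorusSite (![X₀, y] : TorusSite 2 L)) σ) *
                    annihilation (orb (FermionTorus.ofTorusSite (![X₀ - 1, y] : TorusSite 2 L)) σ)) +
                  Complex.I • (creation (orb (FermionTorus.ofTorusSite (![X₀ - 1, y] : TorusSite 2 L)) σ) *
                    annihilation (orb (FermionTorus.ofTorusSite (![X₀, y] : TorusSite 2 L)) σ)))).toBlock
                (fun s => s.card = 2 * ⌊(1 - (1 - n)) * (L : ℝ) ^ 2 / 2⌋₊ ∧
                  2 * (s.filter fun i => (ofLex i).2 = 0).card = 2 * ⌊(1 - (1 - n)) * (L : ℝ) ^ 2 / 2⌋₊)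
                (fun s => s.card = 2 * ⌊(1 - (1 - n)) * (L : ℝ) ^ 2 / 2⌋₊ ∧
                  2 * (s.filter fun i => (ofLex i).2 = 0).card = 2 * ⌊(1 - (1 - n)) * (L : ℝ) ^ 2 / 2⌋₊))‖
            ≤ C * ‖A‖ * (X.card : ℝ) ^ k * Real.exp (-(d : ℝ) / ξ)) ↔
    (0 < ξ ∧ ∃ C : ℝ, ∃ k L₀ : ℕ, ∀ (L : ℕ) [NeZero L], L₀ ≤ L →
      ∀ (X : Finset (FermionTorus 2 L)) (A : Matrix (Finset (Orb (FermionTorus 2 L))) (Finset (Orb (FermionTorus 2 L))) ℂ),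
        A ∈ carSubalgebra (orbSet X) →
        ∀ (X₀ y : ZMod L) (d : ℕ),
          (∀ x ∈ X, d ≤ torusDist x.toTorusSite ![X₀, y] ∧ d ≤ torusDist x.toTorusSite ![X₀ - 1, y]) →
          ‖gibbsState β ((hubbardTorusTT'Flux L 0 U 0).toBlock
                (fun s => s.card = 2 * ⌊(1 - (1 - n)) * (L : ℝ) ^ 2 / 2⌋₊ ∧
                  2 * (s.filter fun i => (ofLex i).2 = 0).card = 2 * ⌊(1 - (1 - n)) * (L : ℝ) ^ 2 / 2⌋₊)
                (fun s => s.card = 2 * ⌊(1 - (1 - n)) * (L : ℝ) ^ 2 / 2⌋₊ ∧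
                  2 * (s.filter fun i => (ofLex i).2 = 0).card = 2 * ⌊(1 - (1 - n)) * (L : ℝ) ^ 2 / 2⌋₊))
              ((A * (∑ σ : Fin 2,
                ((-Complex.I) • (creation (orb (FermionTorus.ofTorusSite (![X₀, y] : TorusSite 2 L)) σ) *
                    annihilation (orb (FermionTorus.ofTorusSite (![X₀ - 1, y] : TorusSite 2 L)) σ)) +
                  Complex.I • (creation (orb (FermionTorus.ofTorusSite (![X₀ - 1, y] : TorusSite 2 L)) σ) *
                    annihilation (orb (FermionTorus.ofTorusSite (![X₀, y] : TorusSite 2 L)) σ))))).toBlock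
                (fun s => s.card = 2 * ⌊(1 - (1 - n)) * (L : ℝ) ^ 2 / 2⌋₊ ∧
                  2 * (s.filter fun i => (ofLex i).2 = 0).card = 2 * ⌊(1 - (1 - n)) * (L : ℝ) ^ 2 / 2⌋₊)
                (fun s => s.card = 2 * ⌊(1 - (1 - n)) * (L : ℝ) ^ 2 / 2⌋₊ ∧
                  2 * (s.filter fun i => (ofLex i).2 = 0).card = 2 * ⌊(1 - (1 - n)) * (L : ℝ) ^ 2 / 2⌋₊))
            - gibbsState β ((hubbardTorusTT'Flux L 0 U 0).toBlock
                (fun s => s.card = 2 * ⌊(1 - (1 - n)) * (L : ℝ) ^ 2 / 2⌋₊ ∧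
                  2 * (s.filter fun i => (ofLex i).2 = 0).card = 2 * ⌊(1 - (1 - n)) * (L : ℝ) ^ 2 / 2⌋₊)
                (fun s => s.card = 2 * ⌊(1 - (1 - n)) * (L : ℝ) ^ 2 / 2⌋₊ ∧
                  2 * (s.filter fun i => (ofLex i).2 = 0).card = 2 * ⌊(1 - (1 - n)) * (L : ℝ) ^ 2 / 2⌋₊))
              (A.toBlock
                (fun s => s.card = 2 * ⌊(1 - (1 - n)) * (L : ℝ) ^ 2 / 2⌋₊ ∧
                  2 * (s.filter fun i => (ofLex i).2 = 0).card = 2 * ⌊(1 - (1 - n)) * (L : ℝ) ^ 2 / 2⌋₊)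
                (fun s => s.card = 2 * ⌊(1 - (1 - n)) * (L : ℝ) ^ 2 / 2⌋₊ ∧
                  2 * (s.filter fun i => (ofLex i).2 = 0).card = 2 * ⌊(1 - (1 - n)) * (L : ℝ) ^ 2 / 2⌋₊))
              * gibbsState β ((hubbardTorusTT'Flux L 0 U 0).toBlock
                (fun s => s.card = 2 * ⌊(1 - (1 - n)) * (L : ℝ) ^ 2 / 2⌋₊ ∧
                  2 * (s.filter fun i => (ofLex i).2 = 0).card = 2 * ⌊(1 - (1 - n)) * (L : ℝ) ^ 2 / 2⌋₊)
                (fun s => s.card = 2 * ⌊(1 - (1 - n)) * (L : ℝ) ^ 2 / 2⌋₊ ∧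
                  2 * (s.filter fun i => (ofLex i).2 = 0).card = 2 * ⌊(1 - (1 - n)) * (L : ℝ) ^ 2 / 2⌋₊))
              ((∑ σ : Fin 2,
                ((-Complex.I) • (creation (orb (FermionTorus.ofTorusSite (![X₀, y] : TorusSite 2 L)) σ) *
                    annihilation (orb (FermionTorus.ofTorusSite (![X₀ - 1, y] : TorusSite 2 L)) σ)) +
                  Complex.I • (creation (orb (FermionTorus.ofTorusSite (![X₀ - 1, y] : TorusSite 2 L)) σ) *
                    annihilation (orb (FermionTorus.ofTorusSite (![X₀, y] : TorusSite 2 L)) σ)))).toBlock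
                (fun s => s.card = 2 * ⌊(1 - (1 - n)) * (L : ℝ) ^ 2 / 2⌋₊ ∧
                  2 * (s.filter fun i => (ofLex i).2 = 0).card = 2 * ⌊(1 - (1 - n)) * (L : ℝ) ^ 2 / 2⌋₊)
                (fun s => s.card = 2 * ⌊(1 - (1 - n)) * (L : ℝ) ^ 2 / 2⌋₊ ∧
                  2 * (s.filter fun i => (ofLex i).2 = 0).card = 2 * ⌊(1 - (1 - n)) * (L : ℝ) ^ 2 / 2⌋₊))‖
            ≤ C * ‖A‖ * (X.card : ℝ) ^ k * Real.exp (-(d : ℝ) / ξ)) := by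
  constructor
  · rintro ⟨hξ, C, k, L₀, h⟩
    refine ⟨hξ, 4 * max C 0, k + 2, L₀, fun L _ hL X A hA X₀ y d hd => ?_⟩
    by_cases hX : X = ∅
    · -- a scalar observable: `𝔄(orbSet ∅) = ⊥`, and `ω_p(j) = 0` (F1)
      subst hX
      obtain ⟨c, hc⟩ := exists_mul_eq_smul_of_mem_carSubalgebra_orbSet_empty hA
      rw [hc, toBlock_smul_eq, map_smul, gibbsState_fluxZeroBlock_farBond_eq_zero L U β X₀ y, smul_zero, mul_zero,
        sub_zero, norm_zero]
      positivity
    · have hXne : X.Nonempty := Finset.nonempty_iff_ne_empty.2 hX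
      -- the hypothesis applied to the local charge pinching `A₀` of `A` (even and local, for ANY local `A`)
      have hb := h L hL X _ (locPinch_mem_of_mem_carSubalgebra hA) X₀ y d hd
      have hJ := farBond_sectorPreserving (FermionTorus.ofTorusSite (![X₀, y] : TorusSite 2 L))
        (FermionTorus.ofTorusSite (![X₀ - 1, y] : TorusSite 2 L)) ⌊(1 - (1 - n)) * (L : ℝ) ^ 2 / 2⌋₊
      -- the covariances of `A₀` and `A` with the current coincide
      rw [toBlock_locPinch_mul_eq hA _ hJ, toBlock_locPinch_eq hA] at hb
      refine hb.trans ?_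
      -- `‖A₀‖ ≤ (|X|+1)² ‖A‖ ≤ 4|X|² ‖A‖`
      have hnorm := norm_locPinch_le X A
      have hcard : ((X.card : ℝ) + 1) ^ 2 ≤ 4 * (X.card : ℝ) ^ 2 := by
        have h1 : (1 : ℝ) ≤ X.card := by exact_mod_cast hXne.card_pos
        nlinarith
      have h3 := mul_le_mul (le_max_left C 0) (hnorm.trans (mul_le_mul_of_nonneg_right hcard (norm_nonneg A)))
        (norm_nonneg _) (le_max_right C 0)
      calc _ ≤ max C 0 * (4 * (X.card : ℝ) ^ 2 * ‖A‖) * (X.card : ℝ) ^ k * Real.exp (-(d : ℝ) / ξ) :=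
            mul_le_mul_of_nonneg_right (mul_le_mul_of_nonneg_right h3 (by positivity)) (by positivity)
        _ = 4 * max C 0 * ‖A‖ * (X.card : ℝ) ^ (k + 2) * Real.exp (-(d : ℝ) / ξ) := by ring
  · rintro ⟨hξ, C, k, L₀, h⟩
    exact ⟨hξ, C, k, L₀, fun L _ hL X A hA X₀ y d hd => h L hL X A (carEvenSubalgebra_le_carSubalgebra _ hA) X₀ y d hd⟩

/-- **F10 — Hypothesis C is clustering against the FULL local algebra.** The line's `CurrentClustering U n β ξ`, unfolded
(`sectorExpect`, `bondCurrent`, `SectorPreserving`, `sectorPred`, `FockOp`; left side = left side of F9's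
`currentClusteringBody_iff_sectorFree`, checked equal by `exact` to the copied definition in the crux work file), is EQUIVALENT to:
"`0 < ξ` and, for constants `C, k, L₀`, uniformly in `L ≥ L₀`, `|ω_p(A j) − ω_p(A) ω_p(j)| ≤ C ‖A‖ |X|^k e^{−d/ξ}` for EVERY
`A ∈ 𝔄(orbSet X)` (any parity, no sector hypothesis) at distance `≥ d` from the bond" — F9 chained with F10a. Every `U`, `n`, `β`, `ξ`.
[folklore] -/
theorem currentClusteringBody_iff_local (U n β ξ : ℝ) :
    (0 < ξ ∧ ∃ C : ℝ, ∃ k L₀ : ℕ, ∀ (L : ℕ) [NeZero L], L₀ ≤ L →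
      ∀ (X : Finset (FermionTorus 2 L)) (A : Matrix (Finset (Orb (FermionTorus 2 L))) (Finset (Orb (FermionTorus 2 L))) ℂ),
        A ∈ carEvenSubalgebra (orbSet X) →
        (∀ s t : Finset (Orb (FermionTorus 2 L)),
          (s.card = 2 * ⌊(1 - (1 - n)) * (L : ℝ) ^ 2 / 2⌋₊ ∧
            2 * (s.filter fun i => (ofLex i).2 = 0).card = 2 * ⌊(1 - (1 - n)) * (L : ℝ) ^ 2 / 2⌋₊) →
          ¬ (t.card = 2 * ⌊(1 - (1 - n)) * (L : ℝ) ^ 2 / 2⌋₊ ∧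
            2 * (t.filter fun i => (ofLex i).2 = 0).card = 2 * ⌊(1 - (1 - n)) * (L : ℝ) ^ 2 / 2⌋₊) →
          A s t = 0 ∧ A t s = 0) →
        ∀ (X₀ y : ZMod L) (d : ℕ),
          (∀ x ∈ X, d ≤ torusDist x.toTorusSite ![X₀, y] ∧ d ≤ torusDist x.toTorusSite ![X₀ - 1, y]) →
          ‖gibbsState β ((hubbardTorusTT'Flux L 0 U 0).toBlock
                (fun s => s.card = 2 * ⌊(1 - (1 - n)) * (L : ℝ) ^ 2 / 2⌋₊ ∧
                  2 * (s.filter fun i => (ofLex i).2 = 0).card = 2 * ⌊(1 - (1 - n)) * (L : ℝ) ^ 2 / 2⌋₊)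
                (fun s => s.card = 2 * ⌊(1 - (1 - n)) * (L : ℝ) ^ 2 / 2⌋₊ ∧
                  2 * (s.filter fun i => (ofLex i).2 = 0).card = 2 * ⌊(1 - (1 - n)) * (L : ℝ) ^ 2 / 2⌋₊))
              ((A * (∑ σ : Fin 2,
                ((-Complex.I) • (creation (orb (FermionTorus.ofTorusSite (![X₀, y] : TorusSite 2 L)) σ) *
                    annihilation (orb (FermionTorus.ofTorusSite (![X₀ - 1, y] : TorusSite 2 L)) σ)) +
                  Complex.I • (creation (orb (FermionTorus.ofTorusSite (![X₀ - 1, y] : TorusSite 2 L)) σ) *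
                    annihilation (orb (FermionTorus.ofTorusSite (![X₀, y] : TorusSite 2 L)) σ))))).toBlock
                (fun s => s.card = 2 * ⌊(1 - (1 - n)) * (L : ℝ) ^ 2 / 2⌋₊ ∧
                  2 * (s.filter fun i => (ofLex i).2 = 0).card = 2 * ⌊(1 - (1 - n)) * (L : ℝ) ^ 2 / 2⌋₊)
                (fun s => s.card = 2 * ⌊(1 - (1 - n)) * (L : ℝ) ^ 2 / 2⌋₊ ∧
                  2 * (s.filter fun i => (ofLex i).2 = 0).card = 2 * ⌊(1 - (1 - n)) * (L : ℝ) ^ 2 / 2⌋₊))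
            - gibbsState β ((hubbardTorusTT'Flux L 0 U 0).toBlock
                (fun s => s.card = 2 * ⌊(1 - (1 - n)) * (L : ℝ) ^ 2 / 2⌋₊ ∧
                  2 * (s.filter fun i => (ofLex i).2 = 0).card = 2 * ⌊(1 - (1 - n)) * (L : ℝ) ^ 2 / 2⌋₊)
                (fun s => s.card = 2 * ⌊(1 - (1 - n)) * (L : ℝ) ^ 2 / 2⌋₊ ∧
                  2 * (s.filter fun i => (ofLex i).2 = 0).card = 2 * ⌊(1 - (1 - n)) * (L : ℝ) ^ 2 / 2⌋₊))
              (A.toBlock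
                (fun s => s.card = 2 * ⌊(1 - (1 - n)) * (L : ℝ) ^ 2 / 2⌋₊ ∧
                  2 * (s.filter fun i => (ofLex i).2 = 0).card = 2 * ⌊(1 - (1 - n)) * (L : ℝ) ^ 2 / 2⌋₊)
                (fun s => s.card = 2 * ⌊(1 - (1 - n)) * (L : ℝ) ^ 2 / 2⌋₊ ∧
                  2 * (s.filter fun i => (ofLex i).2 = 0).card = 2 * ⌊(1 - (1 - n)) * (L : ℝ) ^ 2 / 2⌋₊))
              * gibbsState β ((hubbardTorusTT'Flux L 0 U 0).toBlock
                (fun s => s.card = 2 * ⌊(1 - (1 - n)) * (L : ℝ) ^ 2 / 2⌋₊ ∧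
                  2 * (s.filter fun i => (ofLex i).2 = 0).card = 2 * ⌊(1 - (1 - n)) * (L : ℝ) ^ 2 / 2⌋₊)
                (fun s => s.card = 2 * ⌊(1 - (1 - n)) * (L : ℝ) ^ 2 / 2⌋₊ ∧
                  2 * (s.filter fun i => (ofLex i).2 = 0).card = 2 * ⌊(1 - (1 - n)) * (L : ℝ) ^ 2 / 2⌋₊))
              ((∑ σ : Fin 2,
                ((-Complex.I) • (creation (orb (FermionTorus.ofTorusSite (![X₀, y] : TorusSite 2 L)) σ) *
                    annihilation (orb (FermionTorus.ofTorusSite (![X₀ - 1, y] : TorusSite 2 L)) σ)) +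
                  Complex.I • (creation (orb (FermionTorus.ofTorusSite (![X₀ - 1, y] : TorusSite 2 L)) σ) *
                    annihilation (orb (FermionTorus.ofTorusSite (![X₀, y] : TorusSite 2 L)) σ)))).toBlock
                (fun s => s.card = 2 * ⌊(1 - (1 - n)) * (L : ℝ) ^ 2 / 2⌋₊ ∧
                  2 * (s.filter fun i => (ofLex i).2 = 0).card = 2 * ⌊(1 - (1 - n)) * (L : ℝ) ^ 2 / 2⌋₊)
                (fun s => s.card = 2 * ⌊(1 - (1 - n)) * (L : ℝ) ^ 2 / 2⌋₊ ∧
                  2 * (s.filter fun i => (ofLex i).2 = 0).card = 2 * ⌊(1 - (1 - n)) * (L : ℝ) ^ 2 / 2⌋₊))‖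
            ≤ C * ‖A‖ * (X.card : ℝ) ^ k * Real.exp (-(d : ℝ) / ξ)) ↔
    (0 < ξ ∧ ∃ C : ℝ, ∃ k L₀ : ℕ, ∀ (L : ℕ) [NeZero L], L₀ ≤ L →
      ∀ (X : Finset (FermionTorus 2 L)) (A : Matrix (Finset (Orb (FermionTorus 2 L))) (Finset (Orb (FermionTorus 2 L))) ℂ),
        A ∈ carSubalgebra (orbSet X) →
        ∀ (X₀ y : ZMod L) (d : ℕ),
          (∀ x ∈ X, d ≤ torusDist x.toTorusSite ![X₀, y] ∧ d ≤ torusDist x.toTorusSite ![X₀ - 1, y]) →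
          ‖gibbsState β ((hubbardTorusTT'Flux L 0 U 0).toBlock
                (fun s => s.card = 2 * ⌊(1 - (1 - n)) * (L : ℝ) ^ 2 / 2⌋₊ ∧
                  2 * (s.filter fun i => (ofLex i).2 = 0).card = 2 * ⌊(1 - (1 - n)) * (L : ℝ) ^ 2 / 2⌋₊)
                (fun s => s.card = 2 * ⌊(1 - (1 - n)) * (L : ℝ) ^ 2 / 2⌋₊ ∧
                  2 * (s.filter fun i => (ofLex i).2 = 0).card = 2 * ⌊(1 - (1 - n)) * (L : ℝ) ^ 2 / 2⌋₊))
              ((A * (∑ σ : Fin 2,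
                ((-Complex.I) • (creation (orb (FermionTorus.ofTorusSite (![X₀, y] : TorusSite 2 L)) σ) *
                    annihilation (orb (FermionTorus.ofTorusSite (![X₀ - 1, y] : TorusSite 2 L)) σ)) +
                  Complex.I • (creation (orb (FermionTorus.ofTorusSite (![X₀ - 1, y] : TorusSite 2 L)) σ) *
                    annihilation (orb (FermionTorus.ofTorusSite (![X₀, y] : TorusSite 2 L)) σ))))).toBlock
                (fun s => s.card = 2 * ⌊(1 - (1 - n)) * (L : ℝ) ^ 2 / 2⌋₊ ∧
                  2 * (s.filter fun i => (ofLex i).2 = 0).card = 2 * ⌊(1 - (1 - n)) * (L : ℝ) ^ 2 / 2⌋₊)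
                (fun s => s.card = 2 * ⌊(1 - (1 - n)) * (L : ℝ) ^ 2 / 2⌋₊ ∧
                  2 * (s.filter fun i => (ofLex i).2 = 0).card = 2 * ⌊(1 - (1 - n)) * (L : ℝ) ^ 2 / 2⌋₊))
            - gibbsState β ((hubbardTorusTT'Flux L 0 U 0).toBlock
                (fun s => s.card = 2 * ⌊(1 - (1 - n)) * (L : ℝ) ^ 2 / 2⌋₊ ∧
                  2 * (s.filter fun i => (ofLex i).2 = 0).card = 2 * ⌊(1 - (1 - n)) * (L : ℝ) ^ 2 / 2⌋₊)
                (fun s => s.card = 2 * ⌊(1 - (1 - n)) * (L : ℝ) ^ 2 / 2⌋₊ ∧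
                  2 * (s.filter fun i => (ofLex i).2 = 0).card = 2 * ⌊(1 - (1 - n)) * (L : ℝ) ^ 2 / 2⌋₊))
              (A.toBlock
                (fun s => s.card = 2 * ⌊(1 - (1 - n)) * (L : ℝ) ^ 2 / 2⌋₊ ∧
                  2 * (s.filter fun i => (ofLex i).2 = 0).card = 2 * ⌊(1 - (1 - n)) * (L : ℝ) ^ 2 / 2⌋₊)
                (fun s => s.card = 2 * ⌊(1 - (1 - n)) * (L : ℝ) ^ 2 / 2⌋₊ ∧
                  2 * (s.filter fun i => (ofLex i).2 = 0).card = 2 * ⌊(1 - (1 - n)) * (L : ℝ) ^ 2 / 2⌋₊))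
              * gibbsState β ((hubbardTorusTT'Flux L 0 U 0).toBlock
                (fun s => s.card = 2 * ⌊(1 - (1 - n)) * (L : ℝ) ^ 2 / 2⌋₊ ∧
                  2 * (s.filter fun i => (ofLex i).2 = 0).card = 2 * ⌊(1 - (1 - n)) * (L : ℝ) ^ 2 / 2⌋₊)
                (fun s => s.card = 2 * ⌊(1 - (1 - n)) * (L : ℝ) ^ 2 / 2⌋₊ ∧
                  2 * (s.filter fun i => (ofLex i).2 = 0).card = 2 * ⌊(1 - (1 - n)) * (L : ℝ) ^ 2 / 2⌋₊))
              ((∑ σ : Fin 2,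
                ((-Complex.I) • (creation (orb (FermionTorus.ofTorusSite (![X₀, y] : TorusSite 2 L)) σ) *
                    annihilation (orb (FermionTorus.ofTorusSite (![X₀ - 1, y] : TorusSite 2 L)) σ)) +
                  Complex.I • (creation (orb (FermionTorus.ofTorusSite (![X₀ - 1, y] : TorusSite 2 L)) σ) *
                    annihilation (orb (FermionTorus.ofTorusSite (![X₀, y] : TorusSite 2 L)) σ)))).toBlock
                (fun s => s.card = 2 * ⌊(1 - (1 - n)) * (L : ℝ) ^ 2 / 2⌋₊ ∧
                  2 * (s.filter fun i => (ofLex i).2 = 0).card = 2 * ⌊(1 - (1 - n)) * (L : ℝ) ^ 2 / 2⌋₊)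
                (fun s => s.card = 2 * ⌊(1 - (1 - n)) * (L : ℝ) ^ 2 / 2⌋₊ ∧
                  2 * (s.filter fun i => (ofLex i).2 = 0).card = 2 * ⌊(1 - (1 - n)) * (L : ℝ) ^ 2 / 2⌋₊))‖
            ≤ C * ‖A‖ * (X.card : ℝ) ^ k * Real.exp (-(d : ℝ) / ξ)) :=
  (currentClusteringBody_iff_sectorFree U n β ξ).trans (currentClusteringBody_sectorFree_iff_local U n β ξ)

end Torus

end Summit.Ventures.CertifiedManyBodySolver.Theorems.TcThermcert1.CurrentClusteringLocalAlgebra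

end
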